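import Summits.AtomisticToContinuum.HydrodynamicLimit.Theorems.JParityClosureEvenStressEnskogRung0LocalStatistics
import Summits.AtomisticToContinuum.HydrodynamicLimit.Theorems.JParityClosureEvenStressEnskogOneBodyDeviationRung0
import Summits.AtomisticToContinuum.HydrodynamicLimit.Theorems.JParityClosureEvenStressEnskogVelocityEquilibrationRung0
import Summits.AtomisticToContinuum.HydrodynamicLimit.Theorems.JParityClosureEvenStressEnskogRung0Sides
import HarnessLib

/-!
# Rung 0 of both post-R children of `EvenStressEnskog`, UNCONDITIONALLY
# (line `preshock-kinetic-slaving`, crux `JParityClosure.EvenStressEnskog`, stmt-AtomisticToContinuum-13079 — lead c7, closure of S3b)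

No new mathematics: three compositions of theorems landed by the line.

* `velocityEquilibration_rung0` — **the rung-0 velocity equilibration (L1)₀ is a theorem** (the registered stub
  `stub_velocityEquilibrationRung0` of the line, spelled out): under the canonical (constant-profile) local Gibbs law, for EVERY
  hard-sphere flow family, every `τ > 0`, continuous `χ`, continuous cutoff `k` vanishing on `[η₀, ∞)` and every continuous
  test `F(v, u, θ)` of quadratic growth, the `r`-window one-body statistic `oneBodyStat` is `η`-close in probability to its
  local-Maxwellian prediction `oneBodyPred` (`N → ∞` at fixed `r`, then `r → 0`).  It is the assembly
  `stub_velocityEquilibrationRung0_of_deviation` (p149013: Tonelli, dominated convergence over `𝕋³`, flow invariance, Markov)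
  of the rung-0 local statistics `stub_rung0LocalStatistics` (p144623) and the pointwise `L¹` deviation
  `stub_oneBodyDeviationRung0` (p146349).
* `enskogSide_rung0` — the ENSKOG SIDE at rung 0 (fully Maxwellian prediction `contactPredM` ≈ the crux's own empirical Enskog
  term), by the exact identification identity (`enskogSideRung0_of_velocityEquilibrationRung0`, p140225).
* `contactEven_rung0` — **the CONTACT SIDE at rung 0**: the collision sum of the J-even momentum-transfer marks is `η`-close in
  probability to Enskog's fully Maxwellian prediction with the thermodynamic contact value — the rung 0 of the planners' crux
  child `ContactEvenPreShock` (pre-collisional even contact law of the canonical hard-sphere gas along the TRUE dynamics), from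
  (L1)₀ and the unconditional crux at rung 0 `evenStressEnskog_rung0` (p121729) via `contactSideRung0_of_velocityEquilibrationRung0`
  (p140225).

So the rung-0 bookkeeping square of the recommended split `EvenStressEnskog(PreShock) ⇐ ContactEvenPreShock ∧
VelocityEquilibrationPreShock` is closed: both children hold at global equilibrium, unconditionally.

References: H. van Beijeren, M. H. Ernst, Physica 68 (1973) 437–456; H. Spohn, *Large Scale Dynamics of Interacting Particles*
(1991), Part I §2.3–2.4; S. Chapman, T. G. Cowling (1970), Ch. 16.
-/

noncomputable section

open scoped BigOperators InnerProductSpace Topology ENNReal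
open MeasureTheory Filter Set
open Literature.MathematicalPhysics.KineticTheory Literature.Analysis.FluidPDE
open Literature.MathematicalPhysics.KineticTheory.StationaryMicroscale

namespace Summit.AtomisticToContinuum.HydrodynamicLimit.Theorems.EvenStressEnskog

/-- **(L1)₀ — velocity equilibration at rung 0, unconditionally** (the registered stub `stub_velocityEquilibrationRung0` of the
line `preshock-kinetic-slaving`, derived from its three landed pieces). [folklore] -/
theorem velocityEquilibration_rung0 :
    ∃ η₀ : ℝ, 0 < η₀ ∧ ∀ (a θ : ℝ) (u : V3), 0 < a → 0 < θ → ∃ σ₀ : ℝ, 0 < σ₀ ∧ ∀ σ : ℝ, 0 < σ → σ < σ₀ →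
      ∀ Φ : (N : ℕ) → HardSphereFlow (Torus.geometry (Fin 3)) (hsDiameter σ N) (N + 1),
      ∀ τ : ℝ, 0 < τ →
      ∀ χ : ℝ × T3 → ℝ, Continuous χ → ∀ k : ℝ → ℝ, Continuous k → (∀ b, η₀ ≤ b → k b = 0) →
      ∀ F : V3 × V3 × ℝ → ℝ, Continuous F →
      (∃ C : ℝ, ∀ q, |F q| ≤ C * (1 + ‖q.1‖ ^ 2 + ‖q.2.1‖ ^ 2 + |q.2.2|)) →
      ∀ η δ : ℝ, 0 < η → 0 < δ → ∃ r₀ : ℝ, 0 < r₀ ∧ ∀ r : ℝ, 0 < r → r < r₀ → ∃ N₀ : ℕ, ∀ N : ℕ, N₀ ≤ N →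
        localGibbsLaw σ (fun _ => a) (fun _ => u) (fun _ => θ) N (Φ N)
          {z | η < |oneBodyStat σ N (Φ N) τ χ k F r z - oneBodyPred σ N (Φ N) τ χ k F r z|}
          ≤ ENNReal.ofReal δ :=
  stub_velocityEquilibrationRung0_of_deviation stub_rung0LocalStatistics
    (stub_oneBodyDeviationRung0 stub_rung0LocalStatistics)

/-- **The Enskog side at rung 0, unconditionally**: the fully Maxwellian prediction `contactPredM` of the collision sum of each
J-even mark is `η`-close in probability to the crux's empirical Enskog term `σ³ ∫₀^τ enskogRate ∘ Φ_s ds` under the canonical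
local Gibbs law, for every flow family. [folklore] -/
theorem enskogSide_rung0 :
    ∃ η₀ : ℝ, 0 < η₀ ∧ ∀ (a θ : ℝ) (u : V3), 0 < a → 0 < θ → ∃ σ₀ : ℝ, 0 < σ₀ ∧ ∀ σ : ℝ, 0 < σ → σ < σ₀ →
      ∀ Φ : (N : ℕ) → HardSphereFlow (Torus.geometry (Fin 3)) (hsDiameter σ N) (N + 1), ∀ τ : ℝ, 0 < τ →
      ∀ χ : ℝ × T3 → ℝ, Continuous χ → ∀ g : ℝ → ℝ, Continuous g → (∀ a, η₀ ≤ a → g a = 0) →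
      ∀ k l : Fin 3,
      ∀ η δ : ℝ, 0 < η → 0 < δ → ∃ r₀ : ℝ, 0 < r₀ ∧ ∀ r : ℝ, 0 < r → r < r₀ → ∃ N₀ : ℕ, ∀ N : ℕ, N₀ ≤ N →
        localGibbsLaw σ (fun _ => a) (fun _ => u) (fun _ => θ) N (Φ N)
          {z | η < |contactPredM σ N (Φ N) τ χ g (evenMark k l) r z
                - σ ^ 3 * ∫ s in Set.Icc (0 : ℝ) τ, enskogRate σ N χ g (evenMark k l) r s ((Φ N).flow s z)|}
          ≤ ENNReal.ofReal δ :=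
  enskogSideRung0_of_velocityEquilibrationRung0 velocityEquilibration_rung0

/-- **The contact side at rung 0, unconditionally** — rung 0 of the crux child `ContactEvenPreShock`: under the canonical local
Gibbs law, along EVERY hard-sphere flow family, the collision sum of the J-even momentum-transfer marks `Ξ_P^{kl}` weighted by
`χ g(σ³ρ_r)` is `η`-close in probability to Enskog's fully Maxwellian prediction `contactPredM` (contact value `Y(σ³ρ_r)`,
Maxwellian velocities at the window parameters), `N → ∞` at fixed `r`, then `r → 0`. [folklore] -/
theorem contactEven_rung0 :
    ∃ η₀ : ℝ, 0 < η₀ ∧ ∀ (a θ : ℝ) (u : V3), 0 < a → 0 < θ → ∃ σ₀ : ℝ, 0 < σ₀ ∧ ∀ σ : ℝ, 0 < σ → σ < σ₀ →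
      ∀ Φ : (N : ℕ) → HardSphereFlow (Torus.geometry (Fin 3)) (hsDiameter σ N) (N + 1), ∀ τ : ℝ, 0 < τ →
      ∀ χ : ℝ × T3 → ℝ, Continuous χ → ∀ g : ℝ → ℝ, Continuous g → (∀ a, η₀ ≤ a → g a = 0) →
      ∀ k l : Fin 3,
      ∀ η δ : ℝ, 0 < η → 0 < δ → ∃ r₀ : ℝ, 0 < r₀ ∧ ∀ r : ℝ, 0 < r → r < r₀ → ∃ N₀ : ℕ, ∀ N : ℕ, N₀ ≤ N →
        localGibbsLaw σ (fun _ => a) (fun _ => u) (fun _ => θ) N (Φ N)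
          {z | η < |collisionSum σ N (Φ N) τ χ g (evenMark k l) r z - contactPredM σ N (Φ N) τ χ g (evenMark k l) r z|}
          ≤ ENNReal.ofReal δ :=
  contactSideRung0_of_velocityEquilibrationRung0 velocityEquilibration_rung0

end Summit.AtomisticToContinuum.HydrodynamicLimit.Theorems.EvenStressEnskog

end
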